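import Literature.MathematicalPhysics.QuantumFieldTheory.BalabanImbrieJaffe1984to88.BIJ88MayerExchange5134

/-!
# `BalabanImbrieJaffe1984to88.BIJ88Eq5134TwoSpecies` — T. Bałaban, J. Imbrie, A. Jaffe, *Effective action and cluster properties of the
abelian Higgs model*, Commun. Math. Phys. **114** (1988) 257–315 [BalabanImbrieJaffe1988], §5.13 p. 306 [PDF 50]: **display (5.13.4), its
RIGHT-HAND equality — the exchange of the Mayer sums `Σ_{S_Y}Σ_{S_5}` with the sum over the fillings `{X_α}`, with the printed
`g₂(X_α) = Σ_{S_Y,S_5 compatible with X_α} g₁(X_α)` — DERIVED IN THE HONEST BOOKKEEPING** (companion of `BIJ88MayerExchange5134`, which carries the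
objects and the fixed-Mayer-data bijection; continuation of this seat's gen-8 reading note GAPS.md G-C2-p25-03): summing the fixed-`S` polymer
representations (`BIJ88PolymerRep5134.polymerRep`: cluster configurations of the `S`-DEPENDENT elementary regions) over the Mayer data `S` gives a
TWO-SPECIES POLYMER GAS on the cubes — fillings `Q` by polymers closed under the `S`-independent rules (iii)–(iv), a hard-core sub-family
`M ⊆ Q` of multi-region polymers, weights `Π_{X∈M} g₂ᴮ(X)·Π_{X∈Q∖M} g₂ᴬ(X)` with `g₂ᴬ + g₂ᴮ = g₂` — and the printed all-fillings form
`Σ_{{X_α}} Π g₂(X_α)` equals it plus the hard-core-violating terms.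

statement-level skeleton of published theorems with citation tags; proofs where landed; nothing here is a claim about the Yang–Mills mass gap

PDF held: `paper:balaban1988-cmp114-bij-abelian-higgs-effective-action` (journal page = PDF page + 256); p. 306 = PDF 50, p. 307 = PDF 51 (rendered
and read as images this session, `renders/original-p050-x2.png`, `…p051-x2.png` of the p25 seat).

**The print (verbatim, p. 306).** *"We obtain the following expressions for the dμ^{(k)}_{Λ^{(k)}_{10}}-integral in (5.12.8): Σ_{S_Y}Σ_{S_5}
e^{−V^{(k)}_{const}(Λ^{(k)}_8)} Σ_{{X_α} filling Λ^{(k)}_{10}} Π_α g₁(X_α) = e^{−V^{(k)}_{const}(Λ^{(k)}_8)} Σ_{{X_α}} Π_α g₂(X_α). (5.13.4) Here g₂(X_α) is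
obtained by summing over S_Y, S_5 compatible with X_α (each Y, X is contained in X_α or the corresponding component of Λ^{(k)c}_{11}): g₂(X_α) =
Σ_{S_Y,S_5 compatible with X_α} g₁(X_α)."*

**Setting** (that of `BIJ88MayerExchange5134`): cubes `ι`, `W` = the cubes of Λ₁₀, `adj` = abutting of cubes, `Ys` = the universe of Mayer polymers
(nonempty sets of cubes, a Mayer set being `S ⊆ polysIn Ys W`), `J₀` = the joining sets of the `S`-independent rules (iii)–(iv) (sets of cubes of
`W`), elementary regions of `S` = `regions (J₀ ∪ S) W`, regions abutting = `radj adj`, `localI`/`IsMulti`/`gA`/`gB`/`HardCore`/`AdmLoc`/`gM` as there.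

**What is proved (0 `sorry`, standard axioms, 0 definitions, 0 new `Prop` facts; finite identities).**
* §1 `sum_compat_admLoc_eq` (at a fixed cube filling `Q`: the Mayer sets compatible with `Q`, constrained by the hard core among the polymers they
  make multi-region, resum to `Σ_{M ⊆ Q hard-core} Π_{X∈M} gB X · Π_{X∈Q∖M} gA X` — via `BIJ88Resummation5141.sum_compat_prod_eq_prod_g2`),
  `mem_index_iff` (the two index sets of the exchange), **`exchange5134`**:
  `Σ_{S ⊆ 𝒫(W)} Σ_{P admissible filling of regions(J₀∪S,W)} Π_{K∈P} g (∪K) (S ∩ 𝒫(∪K)) = Σ_{Q filling of W by J₀-closed polymers} Σ_{M ⊆ Q hard-core}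
  Π_{X∈M} gB X · Π_{X∈Q∖M} gA X` for EVERY activity `g`; **`printed_eq_honest_add`**: `Σ_Q Π_{X∈Q} g₂(X) = [that] + Σ_Q Σ_{M ⊆ Q not hard-core} …`.
* §2 WITH THE PRINTED `g₁`: `g1_congr` (the printed activity of a cluster sees only the corner values on it); **`eq5134_right`** — for every Mayer
  set `S` let `z S` be the corner expectations `⟨Π_{i∈X} f_S(□_i)⟩_{1_Λ,X}` on the sets of elementary regions of `S`, cluster-factorizing (`hz`, the
  p. 306 factorization) and local (`hloc`: on a set `K` of regions the expectation is that of the Mayer data inside `∪K` — *"integrating over the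
  fields in X only"*, *"f(□_i) is the product of all the factors … localized in □_i"*); then `Σ_S ⟨Π_{i∈I(S)} f_S(□_i)⟩_1 = Σ_S z S I(S) I(S)` equals
  (left equality of (5.13.4) = `polymerRep` at each `S`, then `exchange5134`) the two-species sum with `g X T := g₁(z T)(localI X T)`;
  `eq5134_right_const` (the factor `e^{−V^{(k)}_{const}(Λ^{(k)}_8)}` on both sides, as printed).
* §3 NON-VACUITY: `eq5134_right_zLoc` — for the local cluster-product data `zLoc` of `BIJ88MayerExchange5134` both hypotheses hold, so
  `eq5134_right` is not an implication from false.

**Reading note (GAPS.md G-C2-p25-03, continued to the `S`-summed display).** (1) Because the □_i depend on `S`, *"{X_α} filling Λ₁₀"* on the left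
of (5.13.4) ranges over cluster configurations of `S`-dependent regions; after the exchange the `S`-independent residue of the constraint is: the
`X_α` are unions of the regions of rules (iii)–(iv) alone (`J₀`-closed), and no two `X_α` that are multi-region FOR THEIR OWN Mayer data abut — a
two-species hard core (single-region polymers, in particular single cubes and the polymers of the p. 307 *"exceptions … when cubes are in a
component of Λ^{(k)c}_{11}, when they support some F^{m̄}_{k,loc}(X_{σ₁}), or when X_α is a single cube"*, may abut anything). (2) With
`g₂ := Σ_{compatible} g₁ = gA + gB` the printed `Σ_{{X_α}} Π g₂(X_α)` equals the expansion plus the hard-core-violating terms (`printed_eq_honest_add`),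
exact iff those vanish — the `S`-summed form of the over-count exhibited at fixed `S` by `BIJ88PolymerRep5134.sum_setPartitions_ne_W4`. (3) The
estimates of p. 307 are per `g₁(X_α; S)` and per Mayer sum, hence insensitive to this bookkeeping; the identity is what changes. NOT summit
progress; NOT continuum; NOT Clay. Imports: `BIJ88MayerExchange5134` only; modifies nothing. Cell `lit-balaban` Phase 2, seat p25 gen 9; row
C2.Eq5.13.3-5.13.4 (owner r16, referee ref-5).
-/

open Finset
open Literature.Probability.LatticeModels (IsSetPartition setPartitions mem_setPartitions)
open Literature.MathematicalPhysics.QuantumFieldTheory.BalabanImbrieJaffe1984to88.BIJ88ElementaryRegions304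
  (IsClosed region regions mem_region mem_region_self region_subset region_subset_of_isClosed isClosed_region inter_subset_region
   region_eq_of_mem isSetPartition_regions mem_regions region_mem_regions regions_restrict_of_isClosed)
open Literature.MathematicalPhysics.QuantumFieldTheory.BalabanImbrieJaffe1984to88.BIJ88Resummation5141
  (polysIn mem_polysIn Compat restrictTo mem_restrictTo g2 sum_compat_prod_eq_prod_g2 filter_compat_polysIn)
open Literature.MathematicalPhysics.QuantumFieldTheory.BalabanImbrieJaffe1984to88.BIJ88Clusters5134
open Literature.MathematicalPhysics.QuantumFieldTheory.BalabanImbrieJaffe1984to88.BIJ88PolymerRep5134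
open Literature.MathematicalPhysics.QuantumFieldTheory.BalabanImbrieJaffe1984to88.BIJ88MayerExchange5134

namespace Literature.MathematicalPhysics.QuantumFieldTheory.BalabanImbrieJaffe1984to88.BIJ88Eq5134TwoSpecies

variable {ι : Type*} [DecidableEq ι]

/-! ## §1 The exchange of the Mayer sum with the filling sum: a two-species polymer gas (with an optional side condition on the
multi-region polymers, used by the resummation (5.14.1) in Λ₁₂ of the companion file) -/

section Exchange

variable {adj : ι → ι → Prop} [DecidableRel adj] {R : Type*} [CommRing R] {J₀ Ys : Finset (Finset ι)} {W : Finset ι}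

omit [DecidableRel adj] in
/-- a product of conditionally vanishing factors is the conditioned product. [cite: BalabanImbrieJaffe1988, (5.13.4) p.306] -/
theorem prod_ite_imp_zero {γ : Type*} (s : Finset γ) (c : γ → Prop) [DecidablePred c] (f : γ → R) :
    ∏ x ∈ s, (if c x then f x else 0) = if (∀ x ∈ s, c x) then ∏ x ∈ s, f x else 0 :=
  prod_ite_zero

/-- **fixed Mayer data, with a side condition on the multi-region polymers** (e.g. *"not abutting an interpolated outer polymer"*, (5.14.1)):
the bijection of `BIJ88MayerExchange5134.sum_admissible_regions_eq` restricted on both sides — admissible fillings of the regions whose members with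
≥ 2 regions have cube content satisfying `p` ↔ closed admissible cube fillings whose polymers containing ≥ 2 regions satisfy `p`.
[cite: BalabanImbrieJaffe1988, (5.13.4) p.306] -/
theorem sum_admissible_regions_eq_cond (J : Finset (Finset ι)) (W : Finset ι) (p : Finset ι → Prop) [DecidablePred p] (F : Finset ι → R) :
    ∑ P ∈ (setPartitions (regions J W)).filter (fun P => IsAdmissible (radj adj) P ∧ ∀ K ∈ P, 2 ≤ K.card → p (K.biUnion id)),
        ∏ K ∈ P, F (K.biUnion id) =
      ∑ Q ∈ (setPartitions W).filter (fun Q => ((∀ X ∈ Q, IsClosed J W X) ∧ AdmGlob adj J W Q) ∧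
          ∀ X ∈ Q, 2 ≤ ((regions J W).filter (· ⊆ X)).card → p X), ∏ X ∈ Q, F X := by
  have h := sum_admissible_regions_eq (adj := adj) J W (fun X => if (2 ≤ ((regions J W).filter (· ⊆ X)).card → p X) then F X else 0)
  -- left side of `h`: the side condition as an indicator, with `(regions J W).filter (· ⊆ ∪K) = K`
  have hL : ∀ P ∈ (setPartitions (regions J W)).filter (IsAdmissible (radj adj)),
      ∏ K ∈ P, (if (2 ≤ ((regions J W).filter (· ⊆ K.biUnion id)).card → p (K.biUnion id)) then F (K.biUnion id) else 0) =
        if (∀ K ∈ P, 2 ≤ K.card → p (K.biUnion id)) then ∏ K ∈ P, F (K.biUnion id) else 0 := by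
    intro P hP
    have hP' : IsSetPartition (regions J W) P := mem_setPartitions.1 (mem_filter.1 hP).1
    have hc : ∀ K ∈ P, (if (2 ≤ ((regions J W).filter (· ⊆ K.biUnion id)).card → p (K.biUnion id)) then F (K.biUnion id) else 0) =
        if (2 ≤ K.card → p (K.biUnion id)) then F (K.biUnion id) else 0 := fun K hK => by
      rw [filter_subset_biUnion (hP'.subset hK)]
    rw [prod_congr rfl hc, prod_ite_imp_zero]
  have hR : ∀ Q ∈ (setPartitions W).filter (fun Q => (∀ X ∈ Q, IsClosed J W X) ∧ AdmGlob adj J W Q),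
      ∏ X ∈ Q, (if (2 ≤ ((regions J W).filter (· ⊆ X)).card → p X) then F X else 0) =
        if (∀ X ∈ Q, 2 ≤ ((regions J W).filter (· ⊆ X)).card → p X) then ∏ X ∈ Q, F X else 0 :=
    fun Q _ => prod_ite_imp_zero Q _ F
  rw [sum_congr rfl hL, sum_congr rfl hR, ← sum_filter, ← sum_filter, filter_filter, filter_filter] at h
  exact h

/-- **the fixed-filling resummation of the Mayer data into the two species, with a condition `Pm` on the multi-region family**: for a filling
`Q` of `W` by polymers, summing `Π_{X∈Q} g X (S ∩ 𝒫(X))` over the Mayer sets `S` compatible with `Q` whose multi-region family satisfies `Pm` gives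
`Σ_{M ⊆ Q, Pm M} Π_{X∈M} gB X · Π_{X∈Q∖M} gA X`. [cite: BalabanImbrieJaffe1988, (5.13.4) p.306] -/
theorem sum_compat_twoSpecies (Pm : Finset (Finset ι) → Prop) [DecidablePred Pm] (hYs : ∀ Y ∈ Ys, Y.Nonempty)
    (g : Finset ι → Finset (Finset ι) → R) {Q : Finset (Finset ι)} (hQ : IsSetPartition W Q) :
    ∑ S ∈ (polysIn Ys W).powerset.filter (fun S => Compat Q S ∧ Pm (multiPart J₀ S Q)), ∏ X ∈ Q, g X (restrictTo S X) =
      ∑ M ∈ Q.powerset.filter Pm, (∏ X ∈ M, gB J₀ Ys g X) * ∏ X ∈ Q \ M, gA J₀ Ys g X := by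
  -- split the index predicate and insert the species vector `M = multiPart S Q`
  have hsplit : (polysIn Ys W).powerset.filter (fun S => Compat Q S ∧ Pm (multiPart J₀ S Q)) =
      ((polysIn Ys W).powerset.filter (Compat Q)).filter (fun S => Pm (multiPart J₀ S Q)) := by
    rw [filter_filter]
  rw [hsplit, sum_filter]
  have hins : ∀ S ∈ (polysIn Ys W).powerset.filter (Compat Q),
      (if Pm (multiPart J₀ S Q) then ∏ X ∈ Q, g X (restrictTo S X) else 0) =
        ∑ M ∈ Q.powerset.filter Pm, ∏ X ∈ Q, gM J₀ M g X (restrictTo S X) := by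
    intro S _
    have hrw : ∀ M ∈ Q.powerset.filter Pm,
        ∏ X ∈ Q, gM J₀ M g X (restrictTo S X) = if multiPart J₀ S Q = M then ∏ X ∈ Q, g X (restrictTo S X) else 0 :=
      fun M hM => prod_gM_eq g (mem_powerset.1 (mem_filter.1 hM).1) S
    rw [sum_congr rfl hrw, sum_ite_eq]
    have hmem : multiPart J₀ S Q ∈ Q.powerset.filter Pm ↔ Pm (multiPart J₀ S Q) := by
      rw [mem_filter]
      exact ⟨fun h => h.2, fun h => ⟨mem_powerset.2 (filter_subset _ _), h⟩⟩
    by_cases hP : Pm (multiPart J₀ S Q)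
    · rw [if_pos hP, if_pos (hmem.2 hP)]
    · rw [if_neg hP, if_neg (fun h => hP (hmem.1 h))]
  rw [sum_congr rfl hins, sum_comm]
  refine sum_congr rfl fun M hM => ?_
  have hMQ : M ⊆ Q := mem_powerset.1 (mem_filter.1 hM).1
  rw [filter_compat_polysIn (fun X hX => hQ.subset hX), sum_compat_prod_eq_prod_g2 Ys hYs (gM J₀ M g) Q hQ.pairwiseDisjoint]
  simp_rw [g2_gM]
  rw [prod_ite, filter_mem_eq_inter, inter_eq_right.2 hMQ]
  congr 1
  refine prod_congr ?_ fun _ _ => rfl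
  rw [sdiff_eq_filter]

/-- inside a closed polymer, "contains ≥ 2 global regions" is "is multi-region for the local Mayer data" (`localI_eq_filter`).
[cite: BalabanImbrieJaffe1988, p.306 (Sect. 5.13)] -/
theorem two_le_card_filter_iff_isMulti {S : Finset (Finset ι)} (hJ : ∀ Y ∈ J₀ ∪ S, Y ⊆ W) {X : Finset ι} (hX : X ⊆ W)
    (hXc : IsClosed (J₀ ∪ S) W X) : 2 ≤ ((regions (J₀ ∪ S) W).filter (· ⊆ X)).card ↔ IsMulti J₀ X (restrictTo S X) := by
  rw [IsMulti, localI_eq_filter hJ hX hXc]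

/-- the index sets of the exchange (with a side condition `p` on the multi-region polymers): (Mayer set `S`, filling with `(J₀ ∪ S)`-closed
blocks, admissible and `p` on the multi-region ones) ↔ (filling with `J₀`-closed blocks, Mayer set compatible with it whose multi-region family is
hard-core and satisfies `p`). [cite: BalabanImbrieJaffe1988, (5.13.4) p.306] -/
theorem mem_index_iff (p : Finset ι → Prop) [DecidablePred p] (hJ₀ : ∀ Y ∈ J₀, Y ⊆ W) (hYs : ∀ Y ∈ Ys, Y.Nonempty)
    (S Q : Finset (Finset ι)) :
    (S ∈ (polysIn Ys W).powerset ∧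
        Q ∈ (setPartitions W).filter (fun Q => ((∀ X ∈ Q, IsClosed (J₀ ∪ S) W X) ∧ AdmGlob adj (J₀ ∪ S) W Q) ∧
          ∀ X ∈ Q, 2 ≤ ((regions (J₀ ∪ S) W).filter (· ⊆ X)).card → p X)) ↔
      (S ∈ (polysIn Ys W).powerset.filter (fun S => Compat Q S ∧
          (HardCore adj (multiPart J₀ S Q) ∧ ∀ X ∈ multiPart J₀ S Q, p X)) ∧
        Q ∈ (setPartitions W).filter (fun Q => ∀ X ∈ Q, IsClosed J₀ W X)) := by
  simp only [mem_filter, mem_powerset]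
  constructor
  · rintro ⟨hS, hQ, ⟨hcl, hadm⟩, hp⟩
    have hQ' := mem_setPartitions.1 hQ
    have hSW : ∀ Y ∈ S, Y ⊆ W := fun Y hY => (mem_polysIn.1 (hS hY)).2
    have hJ : ∀ Y ∈ J₀ ∪ S, Y ⊆ W := fun Y hY => (mem_union.1 hY).elim (hJ₀ Y) (hSW Y)
    have hcl0 : ∀ X ∈ Q, IsClosed J₀ W X := fun X hX => (isClosed_union_iff.1 (hcl X hX)).1
    have hclS : ∀ X ∈ Q, IsClosed S W X := fun X hX => (isClosed_union_iff.1 (hcl X hX)).2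
    refine ⟨⟨hS, (forall_isClosed_iff_compat hSW (fun Y hY => hYs Y (mem_polysIn.1 (hS hY)).1) hQ').1 hclS,
      (admLoc_iff_hardCore_multiPart S Q).1 ((admGlob_iff_admLoc hJ hQ' hcl).1 hadm), fun X hX => ?_⟩, hQ, hcl0⟩
    obtain ⟨hXQ, hm⟩ := mem_filter.1 hX
    exact hp X hXQ ((two_le_card_filter_iff_isMulti hJ (hQ'.subset hXQ) (hcl X hXQ)).2 hm)
  · rintro ⟨⟨hS, hcomp, hhc, hp⟩, hQ, hcl0⟩
    have hQ' := mem_setPartitions.1 hQ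
    have hSW : ∀ Y ∈ S, Y ⊆ W := fun Y hY => (mem_polysIn.1 (hS hY)).2
    have hJ : ∀ Y ∈ J₀ ∪ S, Y ⊆ W := fun Y hY => (mem_union.1 hY).elim (hJ₀ Y) (hSW Y)
    have hclS : ∀ X ∈ Q, IsClosed S W X :=
      (forall_isClosed_iff_compat hSW (fun Y hY => hYs Y (mem_polysIn.1 (hS hY)).1) hQ').2 hcomp
    have hcl : ∀ X ∈ Q, IsClosed (J₀ ∪ S) W X := fun X hX => isClosed_union_iff.2 ⟨hcl0 X hX, hclS X hX⟩
    refine ⟨hS, hQ, ⟨hcl, (admGlob_iff_admLoc hJ hQ' hcl).2 ((admLoc_iff_hardCore_multiPart S Q).2 hhc)⟩, fun X hXQ h2 => ?_⟩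
    exact hp X (mem_filter.2 ⟨hXQ, (two_le_card_filter_iff_isMulti hJ (hQ'.subset hXQ) (hcl X hXQ)).1 h2⟩)

variable (adj J₀ Ys W) in
/-- **the exchange with a side condition on the multi-region polymers**: for every predicate `p` on cube polymers,
`Σ_{S} Σ_{P admissible filling of I(S), p(∪K) for the K ∈ P with ≥ 2 regions} Π_{K∈P} g (∪K) (S ∩ 𝒫(∪K))`
`= Σ_{Q filling of W by J₀-closed polymers} Σ_{M ⊆ Q hard-core, p on M} Π_{X∈M} gB X · Π_{X∈Q∖M} gA X` — the form used by the resummation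
(5.14.1) in Λ₁₂ (`p X` = *"X abuts no interpolated outer polymer"*); `p ≡ True` is (5.13.4) itself (`exchange5134`).
[cite: BalabanImbrieJaffe1988, (5.13.4) p.306] -/
theorem exchange5134_cond (p : Finset ι → Prop) [DecidablePred p] (hJ₀ : ∀ Y ∈ J₀, Y ⊆ W) (hYs : ∀ Y ∈ Ys, Y.Nonempty)
    (g : Finset ι → Finset (Finset ι) → R) :
    ∑ S ∈ (polysIn Ys W).powerset,
        ∑ P ∈ (setPartitions (regions (J₀ ∪ S) W)).filter
            (fun P => IsAdmissible (radj adj) P ∧ ∀ K ∈ P, 2 ≤ K.card → p (K.biUnion id)),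
          ∏ K ∈ P, g (K.biUnion id) (restrictTo S (K.biUnion id)) =
      ∑ Q ∈ (setPartitions W).filter (fun Q => ∀ X ∈ Q, IsClosed J₀ W X),
        ∑ M ∈ Q.powerset.filter (fun M => HardCore adj M ∧ ∀ X ∈ M, p X),
          (∏ X ∈ M, gB J₀ Ys g X) * ∏ X ∈ Q \ M, gA J₀ Ys g X := by
  have h1 : ∀ S ∈ (polysIn Ys W).powerset,
      ∑ P ∈ (setPartitions (regions (J₀ ∪ S) W)).filter
            (fun P => IsAdmissible (radj adj) P ∧ ∀ K ∈ P, 2 ≤ K.card → p (K.biUnion id)),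
          ∏ K ∈ P, g (K.biUnion id) (restrictTo S (K.biUnion id)) =
        ∑ Q ∈ (setPartitions W).filter (fun Q => ((∀ X ∈ Q, IsClosed (J₀ ∪ S) W X) ∧ AdmGlob adj (J₀ ∪ S) W Q) ∧
            ∀ X ∈ Q, 2 ≤ ((regions (J₀ ∪ S) W).filter (· ⊆ X)).card → p X),
          ∏ X ∈ Q, g X (restrictTo S X) :=
    fun S _ => sum_admissible_regions_eq_cond (adj := adj) (J₀ ∪ S) W p (fun X => g X (restrictTo S X))
  rw [sum_congr rfl h1,
    sum_comm' (t' := (setPartitions W).filter (fun Q => ∀ X ∈ Q, IsClosed J₀ W X))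
      (s' := fun Q => (polysIn Ys W).powerset.filter (fun S => Compat Q S ∧
        (HardCore adj (multiPart J₀ S Q) ∧ ∀ X ∈ multiPart J₀ S Q, p X)))
      (fun S Q => mem_index_iff (adj := adj) p hJ₀ hYs S Q)]
  refine sum_congr rfl fun Q hQ => ?_
  exact sum_compat_twoSpecies (fun M => HardCore adj M ∧ ∀ X ∈ M, p X) hYs g (mem_setPartitions.1 (mem_filter.1 hQ).1)

variable (adj J₀ Ys W) in
/-- **DISPLAY (5.13.4), RIGHT-HAND EQUALITY — THE EXCHANGE OF THE MAYER SUM WITH THE FILLING SUM, HONEST FORM** (p. 306 [PDF 50], verbatim: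
*"Σ_{S_Y}Σ_{S_5} e^{−V^{(k)}_{const}(Λ^{(k)}_8)} Σ_{{X_α} filling Λ^{(k)}_{10}} Π_α g₁(X_α) = e^{−V^{(k)}_{const}(Λ^{(k)}_8)} Σ_{{X_α}} Π_α g₂(X_α).
(5.13.4) Here g₂(X_α) is obtained by summing over S_Y, S_5 compatible with X_α (each Y, X is contained in X_α or the corresponding component of
Λ^{(k)c}_{11}): g₂(X_α) = Σ_{S_Y,S_5 compatible with X_α} g₁(X_α)"*). With the elementary regions of the Mayer set `S` being `regions (J₀ ∪ S) W` and
the fixed-`S` expansion ranging over the ADMISSIBLE fillings of them (the cluster configurations, `BIJ88PolymerRep5134`), for every activity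
`g X T` of a cube polymer `X` with local Mayer data `T`:
`Σ_{S ⊆ 𝒫(W)} Σ_{P admissible filling of regions(J₀∪S,W)} Π_{K∈P} g (∪K) (S ∩ 𝒫(∪K))`
`= Σ_{Q filling of W by J₀-closed polymers} Σ_{M ⊆ Q hard-core} Π_{X∈M} gB X · Π_{X∈Q∖M} gA X`
— a two-species polymer gas: the fillings `{X_α}` are by polymers closed under the `S`-independent rules (iii)–(iv), those `X_α` that are
multi-region for their own Mayer data obey a hard core, and `g₂` splits as `gA + gB` accordingly. [cite: BalabanImbrieJaffe1988, (5.13.4) p.306] -/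
theorem exchange5134 (hJ₀ : ∀ Y ∈ J₀, Y ⊆ W) (hYs : ∀ Y ∈ Ys, Y.Nonempty) (g : Finset ι → Finset (Finset ι) → R) :
    ∑ S ∈ (polysIn Ys W).powerset,
        ∑ P ∈ (setPartitions (regions (J₀ ∪ S) W)).filter (IsAdmissible (radj adj)),
          ∏ K ∈ P, g (K.biUnion id) (restrictTo S (K.biUnion id)) =
      ∑ Q ∈ (setPartitions W).filter (fun Q => ∀ X ∈ Q, IsClosed J₀ W X),
        ∑ M ∈ Q.powerset.filter (HardCore adj), (∏ X ∈ M, gB J₀ Ys g X) * ∏ X ∈ Q \ M, gA J₀ Ys g X := by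
  have h := exchange5134_cond adj J₀ Ys W (fun _ => True) hJ₀ hYs g
  have hL : ∀ S : Finset (Finset ι),
      (setPartitions (regions (J₀ ∪ S) W)).filter
          (fun P => IsAdmissible (radj adj) P ∧ ∀ K ∈ P, 2 ≤ K.card → True) =
        (setPartitions (regions (J₀ ∪ S) W)).filter (IsAdmissible (radj adj)) :=
    fun S => filter_congr fun P _ => ⟨fun h' => h'.1, fun h' => ⟨h', fun _ _ _ => trivial⟩⟩
  have hR : ∀ Q : Finset (Finset ι),
      Q.powerset.filter (fun M => HardCore adj M ∧ ∀ X ∈ M, True) = Q.powerset.filter (HardCore adj) :=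
    fun Q => filter_congr fun M _ => ⟨fun h' => h'.1, fun h' => ⟨h', fun _ _ => trivial⟩⟩
  simp only [hL, hR] at h
  exact h

variable (adj J₀ Ys) in
/-- **THE PRINTED ALL-FILLINGS FORM OVER-COUNTS BY THE HARD-CORE VIOLATIONS** (reading note, GAPS.md G-C2-p25-03 continued): with
`g₂ := Σ_{T compatible} g₁ = gA + gB` (`gA_add_gB`), the printed right side of (5.13.4) read over all fillings by `J₀`-closed polymers,
`Σ_Q Π_{X∈Q} g₂(X)`, equals the honest two-species sum of `exchange5134` plus the sum over the sub-families `M ⊆ Q` that VIOLATE the hard core (two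
abutting multi-region polymers) — terms which the cube-wise decoupling expansion does not produce. [cite: BalabanImbrieJaffe1988, (5.13.4) p.306] -/
theorem printed_eq_honest_add (g : Finset ι → Finset (Finset ι) → R) (𝒬 : Finset (Finset (Finset ι))) :
    ∑ Q ∈ 𝒬, ∏ X ∈ Q, g2 Ys g X =
      ∑ Q ∈ 𝒬, ∑ M ∈ Q.powerset.filter (HardCore adj), (∏ X ∈ M, gB J₀ Ys g X) * ∏ X ∈ Q \ M, gA J₀ Ys g X +
        ∑ Q ∈ 𝒬, ∑ M ∈ Q.powerset.filter (fun M => ¬ HardCore adj M), (∏ X ∈ M, gB J₀ Ys g X) * ∏ X ∈ Q \ M, gA J₀ Ys g X := by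
  rw [← sum_add_distrib]
  refine sum_congr rfl fun Q _ => ?_
  rw [sum_filter_add_sum_filter_not]
  have h : ∀ X ∈ Q, g2 Ys g X = gB J₀ Ys g X + gA J₀ Ys g X := fun X _ => by rw [← gA_add_gB J₀ Ys g X, add_comm]
  rw [prod_congr rfl h, prod_add]

end Exchange

/-! ## §2 With the printed activities `g₁` of a local, cluster-factorizing family of corner expectations: the `S`-summed (5.13.4) -/

section Corner

variable {adj : ι → ι → Prop} [DecidableRel adj] {R : Type*} [CommRing R]

omit [DecidableEq ι] in
/-- **the printed activity of a cluster sees only the corner values on that cluster**: `g₁(z)(K)` depends on `z` only through the values `z K Λ`,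
`Λ ⊆ K` (p. 306: *"⟨·⟩_{s_Γ,X} is defined by integrating over the fields in X only"*). [cite: BalabanImbrieJaffe1988, p.306 (Sect. 5.13)] -/
theorem g1_congr {κ : Type*} [DecidableEq κ] (adjκ : κ → κ → Prop) [DecidableRel adjκ] {z z' : Finset κ → Finset κ → R} {K : Finset κ}
    (h : ∀ Λ ⊆ K, z K Λ = z' K Λ) : g1 adjκ z K = g1 adjκ z' K := by
  rw [g1, g1]
  refine sum_congr rfl fun Γ hΓ => ?_
  have hΓK : Γ ⊆ K := mem_powerset.1 (mem_filter.1 hΓ).1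
  rw [cornerSum, cornerSum]
  refine sum_congr rfl fun Λ hΛ => ?_
  rw [h Λ ((mem_powerset.1 hΛ).trans hΓK)]

variable (adj) (J₀ Ys : Finset (Finset ι)) (W : Finset ι)

/-- **the fixed-`S` activity of a cluster is the local activity of its cube content**: for local corner data (`hloc`), the printed activity
`g₁(z S)(K)` of a set `K` of elementary regions of `S` equals `g₁(z T)(localI X T)` with `X = ∪K` its cube content and `T = S ∩ 𝒫(X)` the Mayer
polymers inside it (*"integrating over the fields in X only"*; `localI_eq_filter`, `filter_subset_biUnion`, `g1_congr`).
[cite: BalabanImbrieJaffe1988, p.306 (Sect. 5.13)] -/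
theorem g1_eq_local (hJ₀ : ∀ Y ∈ J₀, Y ⊆ W) (z : Finset (Finset ι) → Finset (Finset ι) → Finset (Finset ι) → R)
    (hloc : ∀ S ⊆ polysIn Ys W, ∀ K ⊆ regions (J₀ ∪ S) W, ∀ Λ ⊆ K, z S K Λ = z (restrictTo S (K.biUnion id)) K Λ)
    {S : Finset (Finset ι)} (hS : S ⊆ polysIn Ys W) {K : Finset (Finset ι)} (hK : K ⊆ regions (J₀ ∪ S) W) :
    g1 (radj adj) (z S) K =
      g1 (radj adj) (z (restrictTo S (K.biUnion id))) (localI J₀ (K.biUnion id) (restrictTo S (K.biUnion id))) := by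
  have hSW : ∀ Y ∈ S, Y ⊆ W := fun Y hY => (mem_polysIn.1 (hS hY)).2
  have hJ : ∀ Y ∈ J₀ ∪ S, Y ⊆ W := fun Y hY => (mem_union.1 hY).elim (hJ₀ Y) (hSW Y)
  -- the cube content of `K` is closed and its local regions are the members of `K`
  have hXW : K.biUnion id ⊆ W := fun v hv => by
    obtain ⟨Rg, hRg, hvR⟩ := mem_biUnion.1 hv
    exact (isSetPartition_regions _ W).subset (hK hRg) hvR
  have hloc' : localI J₀ (K.biUnion id) (restrictTo S (K.biUnion id)) = K := by
    rw [localI_eq_filter hJ hXW (isClosed_biUnion hK), filter_subset_biUnion hK]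
  rw [hloc']
  exact g1_congr (radj adj) fun Λ hΛ => hloc S hS K hK Λ hΛ

/-- **(5.13.4) SUMMED OVER THE MAYER DATA, WITH THE PRINTED `g₁`** — p. 306 [PDF 50], verbatim: *"Σ_{S_Y}Σ_{S_5} e^{−V^{(k)}_{const}(Λ^{(k)}_8)}
Σ_{{X_α} filling Λ^{(k)}_{10}} Π_α g₁(X_α) = e^{−V^{(k)}_{const}(Λ^{(k)}_8)} Σ_{{X_α}} Π_α g₂(X_α). (5.13.4) Here g₂(X_α) is obtained by summing over
S_Y, S_5 compatible with X_α … g₂(X_α) = Σ_{S_Y,S_5 compatible with X_α} g₁(X_α)"*. For every Mayer set `S` let `z S` be the corner expectations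
`⟨Π_{i∈X} f_S(□_i)⟩_{1_Λ,X}` on the sets `X` of elementary regions of `S` (`I(S) = regions (J₀ ∪ S) W`), cluster-factorizing for the abutting of
regions (`hz`; the p. 306 factorization, `BIJ88Clusters5134.IsClusterFactorizing`) and LOCAL (`hloc`: on a set `K` of regions of `S` the
expectation is that of the Mayer data inside `∪K` — *"integrating over the fields in X only"*, *"f(□_i) is the product of all the factors …
localized in □_i"*). Then the `S`-summed left side `Σ_S ⟨Π_{i∈I(S)} f_S(□_i)⟩_1 = Σ_S z S I(S) I(S)` — by the polymer representation
`BIJ88PolymerRep5134.polymerRep` at each `S` (the left equality of (5.13.4)) and `exchange5134` — equals the TWO-SPECIES polymer sum with the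
printed activities `g X T := g₁(z T)(regions of X for T)`: fillings of the cubes by `J₀`-closed polymers, hard core among the multi-region ones,
`gB` on them and `gA` on the others, `gA + gB = Σ_{T compatible} g₁ = g₂`. [cite: BalabanImbrieJaffe1988, (5.13.4) p.306] -/
theorem eq5134_right (hJ₀ : ∀ Y ∈ J₀, Y ⊆ W) (hYs : ∀ Y ∈ Ys, Y.Nonempty)
    (z : Finset (Finset ι) → Finset (Finset ι) → Finset (Finset ι) → R)
    (hz : ∀ S ⊆ polysIn Ys W, IsClusterFactorizing (radj adj) (z S))
    (hloc : ∀ S ⊆ polysIn Ys W, ∀ K ⊆ regions (J₀ ∪ S) W, ∀ Λ ⊆ K, z S K Λ = z (restrictTo S (K.biUnion id)) K Λ) :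
    ∑ S ∈ (polysIn Ys W).powerset, z S (regions (J₀ ∪ S) W) (regions (J₀ ∪ S) W) =
      ∑ Q ∈ (setPartitions W).filter (fun Q => ∀ X ∈ Q, IsClosed J₀ W X),
        ∑ M ∈ Q.powerset.filter (HardCore adj),
          (∏ X ∈ M, gB J₀ Ys (fun X T => g1 (radj adj) (z T) (localI J₀ X T)) X) *
            ∏ X ∈ Q \ M, gA J₀ Ys (fun X T => g1 (radj adj) (z T) (localI J₀ X T)) X := by
  rw [← exchange5134 adj J₀ Ys W hJ₀ hYs (fun X T => g1 (radj adj) (z T) (localI J₀ X T))]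
  refine sum_congr rfl fun S hS => ?_
  have hS' : S ⊆ polysIn Ys W := mem_powerset.1 hS
  rw [polymerRep (hz S hS') (regions (J₀ ∪ S) W)]
  refine sum_congr rfl fun P hP => prod_congr rfl fun K hK => ?_
  exact g1_eq_local adj J₀ Ys W hJ₀ z hloc hS' ((mem_setPartitions.1 (mem_filter.1 hP).1).subset hK)

/-- the same display with the constant factor `e^{−V^{(k)}_{const}(Λ^{(k)}_8)}` in place on both sides, as printed.
[cite: BalabanImbrieJaffe1988, (5.13.4) p.306] -/
theorem eq5134_right_const (hJ₀ : ∀ Y ∈ J₀, Y ⊆ W) (hYs : ∀ Y ∈ Ys, Y.Nonempty) (c : R)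
    (z : Finset (Finset ι) → Finset (Finset ι) → Finset (Finset ι) → R)
    (hz : ∀ S ⊆ polysIn Ys W, IsClusterFactorizing (radj adj) (z S))
    (hloc : ∀ S ⊆ polysIn Ys W, ∀ K ⊆ regions (J₀ ∪ S) W, ∀ Λ ⊆ K, z S K Λ = z (restrictTo S (K.biUnion id)) K Λ) :
    ∑ S ∈ (polysIn Ys W).powerset, c * z S (regions (J₀ ∪ S) W) (regions (J₀ ∪ S) W) =
      c * ∑ Q ∈ (setPartitions W).filter (fun Q => ∀ X ∈ Q, IsClosed J₀ W X),
        ∑ M ∈ Q.powerset.filter (HardCore adj),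
          (∏ X ∈ M, gB J₀ Ys (fun X T => g1 (radj adj) (z T) (localI J₀ X T)) X) *
            ∏ X ∈ Q \ M, gA J₀ Ys (fun X T => g1 (radj adj) (z T) (localI J₀ X T)) X := by
  rw [← mul_sum, eq5134_right adj J₀ Ys W hJ₀ hYs z hz hloc]

end Corner

/-! ## §3 Non-vacuity: `eq5134_right` for the local cluster-product corner data `BIJ88MayerExchange5134.zLoc` -/

section Supply

variable (adj : ι → ι → Prop) [DecidableRel adj] {R : Type*} [CommRing R]

/-- **`eq5134_right` is not vacuous**: for local cluster-product corner data it holds with no hypothesis beyond the nonemptiness of the Mayer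
polymers and the joining sets being sets of cubes of `W`. [cite: BalabanImbrieJaffe1988, (5.13.4) p.306] -/
theorem eq5134_right_zLoc (J₀ Ys : Finset (Finset ι)) (W : Finset ι) (hJ₀ : ∀ Y ∈ J₀, Y ⊆ W) (hYs : ∀ Y ∈ Ys, Y.Nonempty)
    (w : Finset ι → Finset (Finset ι) → R) :
    ∑ S ∈ (polysIn Ys W).powerset, zLoc adj w S (regions (J₀ ∪ S) W) (regions (J₀ ∪ S) W) =
      ∑ Q ∈ (setPartitions W).filter (fun Q => ∀ X ∈ Q, IsClosed J₀ W X),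
        ∑ M ∈ Q.powerset.filter (HardCore adj),
          (∏ X ∈ M, gB J₀ Ys (fun X T => g1 (radj adj) (zLoc adj w T) (localI J₀ X T)) X) *
            ∏ X ∈ Q \ M, gA J₀ Ys (fun X T => g1 (radj adj) (zLoc adj w T) (localI J₀ X T)) X :=
  eq5134_right adj J₀ Ys W hJ₀ hYs (zLoc adj w) (fun S _ => isClusterFactorizing_zLoc adj w S)
    fun S _ K _ Λ _ => zLoc_local adj w S K Λ

end Supply

end Literature.MathematicalPhysics.QuantumFieldTheory.BalabanImbrieJaffe1984to88.BIJ88Eq5134TwoSpecies
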